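import Literature.AnabelianGeometry.SemiGraphs.TemperedCurveHyperbolicWitness
import Literature.AnabelianGeometry.EtaleTheta.ZHatLevelDetermination
import Mathlib.FieldTheory.Galois.Profinite
import HarnessLib

/-!
# [SemiAnbd] Thm. 6.8 (i)(ii) over the ORIGIN certificate, GENUINE-morphism form: the universal
# closure is FALSE over abstract scheme data (schema verdict for FACT-LIST row F-1698)

Mochizuki, *Semi-graphs of anabelioids*, Publ. RIMS **42** (2006) [SemiAnbd], Thm. 6.8 (i)(ii) p. 74
("The tempered fundamental group functor determines equivalences of categories
`DLoc_K(X_K) ⥲ DLoc_{G_K}(Π^temp_{X_K})` …"). [cite: MochizukiSemiAnbd2006, Thm 6.8(i)-(ii) p.74]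

PROOF-ONLY file (abc-iut cell, block F fact-proving wave, tranche 173, seat abc-iut-f-173; no
definition).  `TemperedDLocCategory.lean` (abc-iut-L3-t4) CONSTRUCTS the genuine category
`DLoc_{G_K}(Π^temp_{X_K})` (`DLocObj.dlocCategory X`: outer DOF-type homomorphisms `J₁ → J₂` over `G_K`)
and types Thm. 6.8 (i)(ii) over it for scheme data `DLocSchemeData X` certified by an origin
`Ω : TemperedMorphismOrigin p` (`Ω.DLocGroupTheoreticityGenuineHolds`, FACT-LIST F-1698).  The companion
verdict for the free-category form F-1681 (`not_forall_dLocGroupTheoreticityHolds`, abc-iut-w5-d040) used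
the FREE field `catG`; for the genuine category that device is unavailable.  This file records the
SCHEMA VERDICT for the genuine form:

* `DLocObj.exists_hom_ne_id_toyHyperbolic` — in the GENUINE category over abc-iut-w5-d040's
  non-degenerate toy `TemperedCurve.toyHyperbolic p` (`Π^temp = G_{ℚ_p} × (Ẑ × P)`), the object
  `(Π^temp ↠ Π^temp)` (`DLocObj.toyHyperbolic`, `H = ⊤`, no cusp filled in) has an endomorphism `≠ 𝟙`:
  the class of the continuous automorphism `id × (inv × id)` (over `G_{ℚ_p}`, of DOF-type, `Ẑ` being
  commutative), which is NOT inner — an inner automorphism fixes the central element `(1, η(1), 1)`,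
  while this one inverts it and `η(1) ≠ η(1)⁻¹` in `Ẑ` (level-`3` character; cf. abc-iut-w5-d010's
  `CyclotomeTransport.eta_one_ne_inv`, same automorphism used there against Thm. 6.12's naive datum);
* `DLocObj.not_dLocEquivalence_toyHyperbolic` — hence at the toy scheme data
  `DLocSchemeData.toyHyperbolic` (one object, one morphism, constant "tempered fundamental group
  functor") the typed Thm. 6.8 (i) `TemperedCurve.DLocEquivalence` FAILS: an equivalence is full, and the
  constant functor maps the unique endomorphism to `𝟙`;
* `TemperedMorphismOrigin.not_forall_dLocGroupTheoreticityGenuineHolds` /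
  `not_forall_prime_dLocGroupTheoreticityGenuineHolds` — so `Ω.DLocGroupTheoreticityGenuineHolds` is FALSE
  at the all-certifying origin (every prime `p`; literal all-binder closure at `p = 2`): the certificate
  `IsDLocOrigin` (GENUINE `DLoc_K(X_K)` data) is necessary, exactly as for F-1681.

The other two conjuncts of the bundle hold at this datum for `α = id` (abc-iut-w5-d040:
`TemperedCurve.isoInducesDLocEquivalence_toyHyperbolic_refl`, and Def. 6.7 / the last clause of Thm. 6.8
(ii) in `TemperedCurveHyperbolicWitness.lean`) — cited, not restated.  A refuted universal closure over
ABSTRACT data says only that the origin certificate is load-bearing; nothing of [SemiAnbd] is refuted or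
asserted; the toy is not a curve; no side is taken on [IUTchIII] Cor. 3.12.
-/

noncomputable section

namespace Literature.AnabelianGeometry.SemiGraphs

open CategoryTheory
open Literature.AnabelianGeometry.EtaleTheta

variable (p : ℕ) [Fact p.Prime]

namespace DLocObj

/-- **A non-identity endomorphism of `(Π^temp ↠ Π^temp)` in the GENUINE `DLoc_{G_{ℚ_p}}(Π^temp)` over the
toy**: the class of the continuous automorphism `id × (inv × id)` of `Π^temp = G_{ℚ_p} × (Ẑ × P)` (over
`G_{ℚ_p}`; of DOF-type as a surjection), which is not inner since it inverts the central element
`(1, η(1), 1)` and `η(1) ≠ η(1)⁻¹`. [cite: MochizukiSemiAnbd2006, §6 p.74] -/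
theorem exists_hom_ne_id_toyHyperbolic :
    letI := dlocCategory (TemperedCurve.toyHyperbolic p)
    ∃ f : toyHyperbolic p ⟶ toyHyperbolic p, f ≠ 𝟙 (toyHyperbolic p) := by
  letI := dlocCategory (TemperedCurve.toyHyperbolic p)
  haveI : IsGalois ℚ_[p] (AlgebraicClosure ℚ_[p]) := {}
  haveI : T2Space (GQp p) := krullTopology_t2
  -- `Ẑ` is commutative
  have hcomm : ∀ z w : ZHat, z * w = w * z := fun z w =>
    ZHatLevel.ext_of_level fun n => by rw [map_mul, map_mul, mul_comm]
  -- `α := id × (inv × id)`, a continuous automorphism of `Π^temp`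
  let α : ToyPi p ≃ₜ* ToyPi p :=
    { toFun := fun g => (g.1, ((g.2.1)⁻¹, g.2.2))
      invFun := fun g => (g.1, ((g.2.1)⁻¹, g.2.2))
      left_inv := fun g => by simp
      right_inv := fun g => by simp
      map_mul' := fun g h => by
        refine Prod.ext rfl (Prod.ext ?_ rfl)
        change (g.2.1 * h.2.1)⁻¹ = (g.2.1)⁻¹ * (h.2.1)⁻¹
        rw [mul_inv_rev]
        exact hcomm _ _
      continuous_toFun := by fun_prop
      continuous_invFun := by fun_prop }
  have hαapp : ∀ (g : GQp p) (z : ZHat) (w : Iw p), α (g, (z, w)) = (g, (z⁻¹, w)) := fun _ _ _ => rfl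
  have hαfst : ∀ g : ToyPi p, (α g).1 = g.1 := fun _ => rfl
  -- read on `J = Π^temp/1` through `J ≃ₜ* Π^temp`
  let e : (toyHyperbolic p).J ≃ₜ* (toyHyperbolic p).J :=
    (jTopEquiv p).trans (α.trans (jTopEquiv p).symm)
  have hsymm : ∀ g : (TemperedCurve.toyHyperbolic p).PiTemp,
      (jTopEquiv p).symm g = (toyHyperbolic p).proj ⟨g, Subgroup.mem_top g⟩ := fun g =>
    (jTopEquiv p).injective (by rw [ContinuousMulEquiv.apply_symm_apply, jTopEquiv_proj])
  have he_proj : ∀ h : (toyHyperbolic p).H,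
      e ((toyHyperbolic p).proj h) =
        (toyHyperbolic p).proj ⟨α (h : (TemperedCurve.toyHyperbolic p).PiTemp), Subgroup.mem_top _⟩ := by
    intro h
    change (jTopEquiv p).symm (α (jTopEquiv p ((toyHyperbolic p).proj h))) = _
    rw [jTopEquiv_proj, hsymm]
  have he : ∀ j, (toyHyperbolic p).augJ (e j) = (toyHyperbolic p).augJ j := by
    intro j
    obtain ⟨h, rfl⟩ := QuotientGroup.mk_surjective j
    change (toyHyperbolic p).augJ (e ((toyHyperbolic p).proj h)) = (toyHyperbolic p).augJ ((toyHyperbolic p).proj h)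
    rw [he_proj, augJ_proj, augJ_proj]
    exact hαfst _
  refine ⟨homMk (HomRep.ofEquiv e he), fun hf => ?_⟩
  -- `homMk (ofEquiv e) = 𝟙` says `e` is inner on `J`
  obtain ⟨b, hb⟩ := Quotient.exact hf.symm
  -- evaluate at the class of `x₀ := (1, η(1), 1)`
  let x₀ : (TemperedCurve.toyHyperbolic p).PiTemp := ((1 : GQp p), (ZHatLevel.eta 1, (1 : Iw p)))
  have hx₀ := hb ((toyHyperbolic p).proj ⟨x₀, Subgroup.mem_top _⟩)
  -- left side: `e [x₀] = [α x₀]`; apply `J ≃ₜ* Π^temp`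
  have hL : jTopEquiv p ((HomRep.ofEquiv e he).toHom ((toyHyperbolic p).proj ⟨x₀, Subgroup.mem_top _⟩)) =
      α x₀ := by
    rw [HomRep.ofEquiv_toHom_apply, he_proj, jTopEquiv_proj]
  have hR : jTopEquiv p (b * (HomRep.id (toyHyperbolic p)).toHom
      ((toyHyperbolic p).proj ⟨x₀, Subgroup.mem_top _⟩) * b⁻¹) =
      jTopEquiv p b * x₀ * (jTopEquiv p b)⁻¹ := by
    rw [map_mul, map_mul, map_inv]
    rfl
  have hαx : jTopEquiv p b * x₀ * (jTopEquiv p b)⁻¹ = α x₀ := by rw [← hL, hx₀, hR]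
  -- compare the `Ẑ`-components: `c η(1) c⁻¹ = η(1)` (commutativity) but `(α x₀).2.1 = η(1)⁻¹`
  have h2 := congrArg (fun g : ToyPi p => g.2.1) hαx
  change (jTopEquiv p b).2.1 * ZHatLevel.eta 1 * ((jTopEquiv p b)⁻¹).2.1 = (ZHatLevel.eta 1)⁻¹ at h2
  rw [hcomm _ (ZHatLevel.eta 1), mul_assoc] at h2
  change ZHatLevel.eta 1 * ((jTopEquiv p b).2.1 * ((jTopEquiv p b).2.1)⁻¹) = _ at h2
  rw [mul_inv_cancel, mul_one] at h2
  -- `η(1) ≠ η(1)⁻¹` in `Ẑ`: the level-`3` character reads `1 ≠ -1 (mod 3)` (as in abc-iut-w5-d010's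
  -- `CyclotomeTransport.eta_one_ne_inv`)
  have h3 := congrArg (fun z => Multiplicative.toAdd (ZHatLevel.level 3 z)) h2
  simp only [map_inv, toAdd_inv, ZHatLevel.level_eta, toAdd_ofAdd, Int.cast_one] at h3
  revert h3
  decide

/-- **The typed Thm. 6.8 (i) (`DLocEquivalence`) FAILS at the toy scheme data** `DLocSchemeData.toyHyperbolic`
(one object, one morphism, the constant "tempered fundamental group functor" at `(Π^temp ↠ Π^temp)`): an
equivalence of categories is full, but the unique endomorphism of the source maps to `𝟙`, missing the
non-identity endomorphism of `exists_hom_ne_id_toyHyperbolic`. [cite: MochizukiSemiAnbd2006, Thm 6.8(i) p.74] -/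
theorem not_dLocEquivalence_toyHyperbolic :
    ¬ (TemperedCurve.toyHyperbolic p).DLocEquivalence (DLocSchemeData.toyHyperbolic p).toDLocContext := by
  letI := dlocCategory (TemperedCurve.toyHyperbolic p)
  intro hE
  have hE' : ((Functor.const ToyDLocK).obj (toyHyperbolic p) :
      ToyDLocK ⥤ DLocObj (TemperedCurve.toyHyperbolic p)).IsEquivalence := hE
  obtain ⟨f, hf⟩ := exists_hom_ne_id_toyHyperbolic p
  obtain ⟨u, hu⟩ := ((Functor.const ToyDLocK).obj (toyHyperbolic p)).map_surjective
    (X := ToyDLocK.self) (Y := ToyDLocK.self) f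
  exact hf (hu.symm.trans rfl)

end DLocObj

namespace TemperedMorphismOrigin

/-- **F-1698, schema verdict**: `DLocGroupTheoreticityGenuineHolds` is FALSE at the all-certifying origin —
its Thm. 6.8 (i) conjunct `DLocEquivalence` fails at the toy scheme data (the genuine `DLoc_{G_K}(Π^temp)`
over the toy has a non-identity automorphism of `(Π^temp ↠ Π^temp)`, invisible to a one-morphism
`DLoc_K`).  The certificate `IsDLocOrigin` (GENUINE `DLoc_K(X_K)` data) is necessary; only instance forms at
genuine data can be facts. [cite: MochizukiSemiAnbd2006, Thm 6.8(i)-(ii) p.74] -/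
theorem not_forall_dLocGroupTheoreticityGenuineHolds (p : ℕ) [Fact p.Prime] :
    ¬ ∀ Ω : TemperedMorphismOrigin p, Ω.DLocGroupTheoreticityGenuineHolds := by
  intro h
  let Ω : TemperedMorphismOrigin p :=
    { IsHyperbolicCurveOrigin := fun _ => True
      IsDomHomOrigin := fun _ => True
      IsDLocOrigin := fun _ => True
      IsFlagsOrigin := fun _ => True }
  exact DLocObj.not_dLocEquivalence_toyHyperbolic p
    (h Ω (TemperedCurve.toyHyperbolic p) (TemperedCurve.toyHyperbolic p) (DLocSchemeData.toyHyperbolic p)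
      (DLocSchemeData.toyHyperbolic p) trivial trivial trivial trivial).1

/-- The universal closure of `TemperedMorphismOrigin.DLocGroupTheoreticityGenuineHolds` over ALL its
binders (the prime `p` included) is false — instantiated at `p = 2`.
[cite: MochizukiSemiAnbd2006, Thm 6.8(i)-(ii) p.74] -/
theorem not_forall_prime_dLocGroupTheoreticityGenuineHolds :
    ¬ ∀ (p : ℕ) [Fact p.Prime] (Ω : TemperedMorphismOrigin p),
        Literature.AnabelianGeometry.SemiGraphs.TemperedMorphismOrigin.DLocGroupTheoreticityGenuineHolds Ω :=
  fun h => not_forall_dLocGroupTheoreticityGenuineHolds 2 (@h 2 ⟨Nat.prime_two⟩)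

end TemperedMorphismOrigin

end Literature.AnabelianGeometry.SemiGraphs

end
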